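import Summits.Ventures.LatticeQCDFlow.Exactness.IMHEveryStartRateUnboundedWeights
import Summits.Ventures.LatticeQCDFlow.Exactness.IMHCoupledUnbiasedEstimatorUnboundedWeights
import HarnessLib

/-!
# The every-start rate for OBSERVABLES without a weight bound: for every bounded measurable `f` and every starting configuration `x`,
# `|π f − (δ_xK^b) f| ≤ (c − a)·(π{w > M} + (1 − E_q[min(1, w)]/max(1, w(x), M))^b)`

HONEST FRAMING: exact (Metropolis-corrected) sampling algorithms for lattice gauge theory;
figures of merit are autocorrelation/cost numbers at stated couplings and volumes; no
continuum-physics claim.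

Venture `LatticeQCDFlow` (cell pub-lqcd), topic `Exactness`; FANOUT row 30 (lean-1, GEN-40).  NEW WORK of the cell (standard Borel `Ω`,
`MeasurableEq Ω`; every proposal law; NO bound on `w`); sequel to this generation's `…EveryStartRateUnboundedWeights` (the same bound for EVENTS
`S`, i.e. in total variation) and `…CoupledUnbiasedEstimatorUnboundedWeights` (the coupling inequality for a bounded observable).  The witness is
the same: a stationary run beside the production run on one stream of random numbers (`μ̂₀ = π ⊗ δ_x`); its disagreement probability at time `b`
is isolated here as an `ℝ≥0∞` quantity and bounded once, so that events and observables read the same rate.  `A = imhAcceptMass q w`,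
`c₁ = E_q[min(1, w)]` (`= 1 − TV(π, q) ≥` the equilibrium acceptance, `…FlowDivergenceDictionary`):

* §1 **`witnessCoupling_offDiagonal_eq`** — `((π ⊗ δ_x)K̂^b)(Δᶜ) = ∫_{w(x) ≤ w}∖{x} (1 − A)^b dπ + ∫_{w < w(x)} (1 − A(x))^b dπ`;
  **`witnessCoupling_offDiagonal_le_rate`** — `≤ ∫ (1 − c₁/max(1, w(x), w))^b dπ`; **`witnessCoupling_offDiagonal_le_tail`** — `≤ π{w > M} + (1 − c₁/max(1, w(x), M))^b`.
* §2 **`imh_everyStart_integral_sub_abs_le_tail`** — THE RATE FOR MEASUREMENTS: `a ≤ f ≤ c` measurable, every `x`, `b`, `M`: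
  `|π f − ∫ f d(δ_xK^b)| ≤ (c − a)·(π{w > M} + (1 − c₁/max(1, w(x), M))^b).toReal` — the bias of every bounded measurement of the production run from any
  configuration decays at the weight-tail rate, with MODEL constants only.
Reading (gauge files): the expectation of a bounded observable under an exact flow-driven gauge sampler started from any configuration approaches
its target value at the displayed weight-tail rate — exactness costs autocorrelation, never bias, also beyond uniform ergodicity.
NOT CLAIMED: a lower bound; unbounded observables.  No `sorry`, no new definitions, nothing cited as a fact.
-/

noncomputable section

namespace Summit.Ventures.LatticeQCDFlow.Exactness

open MeasureTheory ProbabilityTheory Function Finset Filter Set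
open scoped _root_.ENNReal unitInterval Topology
open Summit.Ventures.LatticeQCDFlow.Scoring

variable {Ω : Type*} [MeasurableSpace Ω] {q : Measure Ω} [IsProbabilityMeasure q] {w : Ω → ℝ}

/-! ## §1 The witness coupling's disagreement probability, bounded once -/

/-- **THE WITNESS COUPLING'S DISAGREEMENT PROBABILITY**: for `μ̂₀ = π ⊗ δ_x` and every `b` (standard Borel `Ω`, every proposal law),
`(μ̂₀K̂^b)(Δᶜ) = ∫_{w(x) ≤ w(y)}∖{x} (1 − A(y))^b dπ + ∫_{w(y) < w(x)} (1 − A(x))^b dπ`. [ours] -/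
theorem witnessCoupling_offDiagonal_eq [StandardBorelSpace Ω] [Nonempty Ω] [MeasurableSingletonClass Ω] [MeasurableEq Ω]
    (hw : Measurable w) (hw0 : ∀ y, 0 < w y) [IsProbabilityMeasure (q.withDensity fun y => ENNReal.ofReal (w y))]
    (Khat : Kernel (Ω × Ω) (Ω × Ω)) [IsMarkovKernel Khat]
    (hK : ∀ z : Ω × Ω, Khat z = (q.prod (volume : Measure unitInterval)).map (fun p : Ω × unitInterval =>
      ((if (p.2 : ℝ) * w z.1 ≤ w p.1 then p.1 else z.1), (if (p.2 : ℝ) * w z.2 ≤ w p.1 then p.1 else z.2))))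
    (x : Ω) (b : ℕ) :
    ((fun m : Measure (Ω × Ω) => m.bind Khat)^[b] ((q.withDensity fun y => ENNReal.ofReal (w y)).prod (Measure.dirac x))) (Set.diagonal Ω)ᶜ =
      ∫⁻ y in {y | w x ≤ w y} ∩ {x}ᶜ, (1 - imhAcceptMass q w y) ^ b ∂(q.withDensity fun y => ENNReal.ofReal (w y)) +
        ∫⁻ _ in {y | w x ≤ w y}ᶜ, (1 - imhAcceptMass q w x) ^ b ∂(q.withDensity fun y => ENNReal.ofReal (w y)) := by
  set π : Measure Ω := q.withDensity fun y => ENNReal.ofReal (w y) with hπ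
  rw [iterate_bind_crnPair_offDiagonal_eq_anyCoupling_atoms hw hw0 Khat hK b (π.prod (Measure.dirac x))]
  have hD : MeasurableSet (Set.diagonal Ω) := measurableSet_diagonal
  have hOm : MeasurableSet {p : Ω × Ω | w p.2 ≤ w p.1} := measurableSet_le (hw.comp measurable_snd) (hw.comp measurable_fst)
  have hAm : Measurable (imhAcceptMass q w) := measurable_imhAcceptMass q hw
  have hφ : Measurable fun y : Ω => (y, x) := measurable_id.prodMk measurable_const
  have hpre1 : (fun y : Ω => (y, x)) ⁻¹' ({p : Ω × Ω | w p.2 ≤ w p.1} ∩ (Set.diagonal Ω)ᶜ) = {y | w x ≤ w y} ∩ {x}ᶜ := by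
    ext y; simp [Set.mem_diagonal_iff]
  have hpre2 : (fun y : Ω => (y, x)) ⁻¹' ({p : Ω × Ω | w p.2 ≤ w p.1}ᶜ ∩ (Set.diagonal Ω)ᶜ) = {y | w x ≤ w y}ᶜ := by
    ext y
    simp only [Set.preimage_inter, Set.preimage_compl, Set.mem_inter_iff, Set.mem_compl_iff, Set.mem_preimage, Set.mem_setOf_eq,
      Set.mem_diagonal_iff]
    constructor
    · exact fun h => h.1
    · intro h
      refine ⟨h, fun hyx => h ?_⟩
      rw [hyx]
  have hm1 : Measurable fun p : Ω × Ω => (1 - imhAcceptMass q w p.1) ^ b := (measurable_const.sub (hAm.comp measurable_fst)).pow_const b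
  have hm2 : Measurable fun p : Ω × Ω => (1 - imhAcceptMass q w p.2) ^ b := (measurable_const.sub (hAm.comp measurable_snd)).pow_const b
  rw [Measure.prod_dirac, setLIntegral_map (hOm.inter hD.compl) hm1 hφ, setLIntegral_map (hOm.compl.inter hD.compl) hm2 hφ, hpre1, hpre2]
  try rfl

/-- **`(μ̂₀K̂^b)(Δᶜ) ≤ ∫ (1 − c₁/max(1, w(x), w(y)))^b π(dy)`** for the witness coupling. [ours] -/
theorem witnessCoupling_offDiagonal_le_rate [StandardBorelSpace Ω] [Nonempty Ω] [MeasurableSingletonClass Ω] [MeasurableEq Ω]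
    (hw : Measurable w) (hw0 : ∀ y, 0 < w y) [IsProbabilityMeasure (q.withDensity fun y => ENNReal.ofReal (w y))]
    (Khat : Kernel (Ω × Ω) (Ω × Ω)) [IsMarkovKernel Khat]
    (hK : ∀ z : Ω × Ω, Khat z = (q.prod (volume : Measure unitInterval)).map (fun p : Ω × unitInterval =>
      ((if (p.2 : ℝ) * w z.1 ≤ w p.1 then p.1 else z.1), (if (p.2 : ℝ) * w z.2 ≤ w p.1 then p.1 else z.2))))
    (x : Ω) (b : ℕ) :
    ((fun m : Measure (Ω × Ω) => m.bind Khat)^[b] ((q.withDensity fun y => ENNReal.ofReal (w y)).prod (Measure.dirac x))) (Set.diagonal Ω)ᶜ ≤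
      ∫⁻ y, (1 - (∫⁻ u, ENNReal.ofReal (min 1 (w u)) ∂q) / ENNReal.ofReal (max 1 (max (w x) (w y)))) ^ b
        ∂(q.withDensity fun y => ENNReal.ofReal (w y)) := by
  set π : Measure Ω := q.withDensity fun y => ENNReal.ofReal (w y) with hπ
  set c : ℝ≥0∞ := ∫⁻ u, ENNReal.ofReal (min 1 (w u)) ∂q with hc
  set g : Ω → ℝ≥0∞ := fun y => (1 - c / ENNReal.ofReal (max 1 (max (w x) (w y)))) ^ b with hg
  rw [witnessCoupling_offDiagonal_eq hw hw0 Khat hK x b]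
  have hmono : ∀ {z y : Ω}, w z ≤ max (w x) (w y) → (1 - imhAcceptMass q w z) ^ b ≤ g y := fun {z y} hzy =>
    (one_sub_imhAcceptMass_pow_le hw0 z b).trans (pow_le_pow_left' (tsub_le_tsub_left
      (ENNReal.div_le_div_left (ENNReal.ofReal_le_ofReal (max_le_max le_rfl hzy)) _) 1) b)
  calc ∫⁻ y in {y | w x ≤ w y} ∩ {x}ᶜ, (1 - imhAcceptMass q w y) ^ b ∂π + ∫⁻ _ in {y | w x ≤ w y}ᶜ, (1 - imhAcceptMass q w x) ^ b ∂π
      ≤ ∫⁻ y in {y | w x ≤ w y} ∩ {x}ᶜ, g y ∂π + ∫⁻ y in {y | w x ≤ w y}ᶜ, g y ∂π :=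
        add_le_add (setLIntegral_mono' ((measurableSet_le measurable_const hw).inter (measurableSet_singleton x).compl)
            fun y _ => hmono (le_max_right _ _))
          (setLIntegral_mono' (measurableSet_le measurable_const hw).compl fun y _ => hmono (le_max_left _ _))
    _ ≤ ∫⁻ y in {y | w x ≤ w y}, g y ∂π + ∫⁻ y in {y | w x ≤ w y}ᶜ, g y ∂π :=
        add_le_add (lintegral_mono_set Set.inter_subset_left) le_rfl
    _ = ∫⁻ y, g y ∂π := lintegral_add_compl g (measurableSet_le measurable_const hw)

/-- **`(μ̂₀K̂^b)(Δᶜ) ≤ π{w > M} + (1 − c₁/max(1, w(x), M))^b`** for the witness coupling and every level `M`. [ours] -/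
theorem witnessCoupling_offDiagonal_le_tail [StandardBorelSpace Ω] [Nonempty Ω] [MeasurableSingletonClass Ω] [MeasurableEq Ω]
    (hw : Measurable w) (hw0 : ∀ y, 0 < w y) [IsProbabilityMeasure (q.withDensity fun y => ENNReal.ofReal (w y))]
    (Khat : Kernel (Ω × Ω) (Ω × Ω)) [IsMarkovKernel Khat]
    (hK : ∀ z : Ω × Ω, Khat z = (q.prod (volume : Measure unitInterval)).map (fun p : Ω × unitInterval =>
      ((if (p.2 : ℝ) * w z.1 ≤ w p.1 then p.1 else z.1), (if (p.2 : ℝ) * w z.2 ≤ w p.1 then p.1 else z.2))))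
    (x : Ω) (b : ℕ) (M : ℝ) :
    ((fun m : Measure (Ω × Ω) => m.bind Khat)^[b] ((q.withDensity fun y => ENNReal.ofReal (w y)).prod (Measure.dirac x))) (Set.diagonal Ω)ᶜ ≤
      (q.withDensity fun y => ENNReal.ofReal (w y)) {y | M < w y} +
        (1 - (∫⁻ u, ENNReal.ofReal (min 1 (w u)) ∂q) / ENNReal.ofReal (max 1 (max (w x) M))) ^ b := by
  set π : Measure Ω := q.withDensity fun y => ENNReal.ofReal (w y) with hπ
  set c : ℝ≥0∞ := ∫⁻ u, ENNReal.ofReal (min 1 (w u)) ∂q with hc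
  set g : Ω → ℝ≥0∞ := fun y => (1 - c / ENNReal.ofReal (max 1 (max (w x) (w y)))) ^ b with hg
  set G : ℝ≥0∞ := (1 - c / ENNReal.ofReal (max 1 (max (w x) M))) ^ b with hG
  refine (witnessCoupling_offDiagonal_le_rate hw hw0 Khat hK x b).trans ?_
  have hTm : MeasurableSet {y | M < w y} := measurableSet_lt measurable_const hw
  have hg1 : ∀ y, g y ≤ 1 := fun y => (pow_le_pow_left' tsub_le_self b).trans_eq (one_pow b)
  have hgG : ∀ y ∈ {y | M < w y}ᶜ, g y ≤ G := fun y hy => by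
    simp only [Set.mem_compl_iff, Set.mem_setOf_eq, not_lt] at hy
    exact pow_le_pow_left' (tsub_le_tsub_left
      (ENNReal.div_le_div_left (ENNReal.ofReal_le_ofReal (max_le_max le_rfl (max_le_max le_rfl hy))) _) 1) b
  calc ∫⁻ y, g y ∂π = ∫⁻ y in {y | M < w y}, g y ∂π + ∫⁻ y in {y | M < w y}ᶜ, g y ∂π := (lintegral_add_compl g hTm).symm
    _ ≤ ∫⁻ y in {y | M < w y}, 1 ∂π + ∫⁻ y in {y | M < w y}ᶜ, G ∂π :=
        add_le_add (setLIntegral_mono' hTm fun y _ => hg1 y) (setLIntegral_mono' hTm.compl hgG)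
    _ ≤ π {y | M < w y} + G := by
        rw [setLIntegral_const, setLIntegral_const, one_mul]
        exact add_le_add le_rfl (mul_le_of_le_one_right' prob_le_one)

/-! ## §2 The rate for measurements -/

/-- **THE EVERY-START RATE FOR A BOUNDED OBSERVABLE WITHOUT A WEIGHT BOUND**: `a ≤ f ≤ c` measurable; for every `x`, `b` and level `M`,
`|π f − ∫ f d(δ_xK^b)| ≤ (c − a)·(π{w > M} + (1 − c₁/max(1, w(x), M))^b).toReal`. [ours] -/
theorem imh_everyStart_integral_sub_abs_le_tail [StandardBorelSpace Ω] [Nonempty Ω] [MeasurableSingletonClass Ω] [MeasurableEq Ω]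
    (hw : Measurable w) (hw0 : ∀ y, 0 < w y) [IsProbabilityMeasure (q.withDensity fun y => ENNReal.ofReal (w y))]
    (x : Ω) {f : Ω → ℝ} (hf : Measurable f) {a c : ℝ} (ha : ∀ y, a ≤ f y) (hc : ∀ y, f y ≤ c) (b : ℕ) (M : ℝ) :
    |∫ y, f y ∂(q.withDensity fun y => ENNReal.ofReal (w y)) - ∫ y, f y ∂((fun m : Measure Ω => m.bind (indepMH q w))^[b] (Measure.dirac x))| ≤
      (c - a) * ((q.withDensity fun y => ENNReal.ofReal (w y)) {y | M < w y} +
        (1 - (∫⁻ u, ENNReal.ofReal (min 1 (w u)) ∂q) / ENNReal.ofReal (max 1 (max (w x) M))) ^ b).toReal := by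
  haveI : Fact (Measurable w) := ⟨hw⟩
  obtain ⟨Khat, hMarkov, hK⟩ := exists_crnPairKernel (q := q) hw
  haveI := hMarkov
  set π : Measure Ω := q.withDensity fun y => ENNReal.ofReal (w y) with hπ
  set μ₀ : Measure (Ω × Ω) := π.prod (Measure.dirac x) with hμ₀
  haveI : IsProbabilityMeasure μ₀ := by rw [hμ₀]; infer_instance
  haveI := isProbabilityMeasure_iterate_bind (κ := Khat) μ₀ b
  have hfst : μ₀.map Prod.fst = π := Measure.map_fst_prod.trans (by simp)
  have hsnd : μ₀.map Prod.snd = Measure.dirac x := Measure.map_snd_prod.trans (by simp)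
  have hca : 0 ≤ c - a := by linarith [ha x, hc x]
  have h := integral_iterate_bind_fst_sub_snd_abs_le_offDiagonal hw hw0 Khat hK μ₀ hf ha hc b
  rw [hfst, hsnd, iterate_bind_indepMH_target hw hw0 b] at h
  refine h.trans (mul_le_mul_of_nonneg_left ?_ hca)
  rw [measureReal_def]
  refine ENNReal.toReal_mono (ENNReal.add_ne_top.2 ⟨measure_ne_top π _, ?_⟩) (witnessCoupling_offDiagonal_le_tail hw hw0 Khat hK x b M)
  exact ne_top_of_le_ne_top ENNReal.one_ne_top ((pow_le_pow_left' tsub_le_self b).trans_eq (one_pow b))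

end Summit.Ventures.LatticeQCDFlow.Exactness

end
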